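import Literature.AlgebraicGeometry.Frobenioids.ArithmeticFrobenioidThm64ivArchRigidity
import HarnessLib

/-!
# Frobenioids I, Theorem 6.4 (iv) AT THE CONSTRUCTIONS: `Ψ^Base` on `Aut(X)` is conjugation by a field
# isomorphism, and the compatibility clause `F₁ ≅ F₂` — non-CM case (archimedean action faithful)

Mochizuki, *The geometry of Frobenioids I: the general theory*, Kyushu J. Math. **62** (2008) 293–400, §6,
Thm. 6.4 (iv) p. 115 l. 23–29: «the corresponding [via `Ψ^Base`] finite extension `L₂ ⊆ F̃₂` of `F₂` is isomorphic to
`L₁` in a fashion that is compatible with an isomorphism `F₁ ⥲ F₂`» [cite: MochizukiFrdI2008, Thm. 6.4 (iv) p.115].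

PROOF-ONLY file (cell abc-iut, layer L1, seat abc-iut-L1-d3 gen 4; GAP-LEDGER G-L1t3-1 #2 general case —
supplement to abc-iut-w4-d090's row; 0 definitions, no named facts).
* `exists_baseRingEquiv_of_conj` — field theory: if a ring isomorphism `e' : L₁ ⥲ L₂` (`L₁/ℚ` Galois, `L₂/F₂`
  Galois) intertwines `Gal(L₁/F₁)` and `Gal(L₂/F₂)` ELEMENTWISE in both directions, then `e'` carries `F₁` onto
  `F₂`: the clause with `e := e'`.
* `Thm64iv_arith_compat_of_faithful` — **the printed clause AT THE DATA for every `F₁` whose `X.L` has a faithful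
  Galois action on its infinite places** (every totally real, and every non-CM totally imaginary, Galois `L₁`; no
  «solitary» / degree / Sylow binder): by `arith_archTransport_galois` the archimedean transport is `s • ·` for some
  `s ∈ Gal(L₁/ℚ)`; equivariance of `π_∞` then reads `e₁⁻¹ ∘ Ψ^Base(h) ∘ e₁ ≡ s h s⁻¹` modulo the kernel of the action
  on infinite places, which is trivial by hypothesis, so `e := e₁ ∘ s` intertwines and the clause follows.
The CM case (kernel `{1, c}`) is the companion file `…Thm64ivCM.lean`.  Nothing here bears on [IUTchIII] Cor. 3.12.
-/

noncomputable section

namespace Literature.AlgebraicGeometry.Frobenioids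

open CategoryTheory Opposite NumberField NumberField.InfinitePlace
open Literature.NumberTheory.NumberFields

/-! ### Field theory: an isomorphism intertwining the two Galois groups carries `F₁` onto `F₂` -/

section FieldTheory

variable {F₁ F₂ L₁ L₂ : Type} [Field F₁] [Field F₂] [Field L₁] [Field L₂]
  [NumberField F₁] [NumberField F₂] [NumberField L₁] [NumberField L₂] [Algebra F₁ L₁] [Algebra F₂ L₂]

/-- From an injective set map `F₁ → L₂` landing in the image of `F₂` one gets a map `F₁ → F₂`; if it comes from
ring homomorphisms it is a ring homomorphism. [cite: MochizukiFrdI2008, Thm. 6.4 (iv) p.115] -/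
theorem exists_ringHom_of_range (f : F₁ →+* L₂) (hf : ∀ a : F₁, ∃ b : F₂, f a = algebraMap F₂ L₂ b) :
    ∃ φ : F₁ →+* F₂, ∀ a, f a = algebraMap F₂ L₂ (φ a) := by
  choose g hg using hf
  have hinj : Function.Injective (algebraMap F₂ L₂) := (algebraMap F₂ L₂).injective
  refine ⟨{ toFun := g
            map_one' := hinj (by rw [← hg, map_one, map_one])
            map_mul' := fun a b => hinj (by rw [← hg, map_mul, map_mul, hg, hg])
            map_zero' := hinj (by rw [← hg, map_zero, map_zero])
            map_add' := fun a b => hinj (by rw [← hg, map_add, map_add, hg, hg]) }, fun a => hg a⟩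

/-- **An isomorphism `e' : L₁ ⥲ L₂` intertwining `Gal(L₁/F₁)` and `Gal(L₂/F₂)` elementwise restricts to
`F₁ ⥲ F₂`** (`L₁/F₁`, `L₂/F₂` Galois): the clause of Thm. 6.4 (iv) with `e := e'`.
[cite: MochizukiFrdI2008, Thm. 6.4 (iv) p.115] -/
theorem exists_baseRingEquiv_of_conj [IsGalois F₁ L₁] [IsGalois F₂ L₂] (e' : L₁ ≃+* L₂)
    (h₁₂ : ∀ τ₂ : L₂ ≃ₐ[F₂] L₂, ∃ τ₁ : L₁ ≃ₐ[F₁] L₁, ∀ x, τ₂ (e' x) = e' (τ₁ x))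
    (h₂₁ : ∀ τ₁ : L₁ ≃ₐ[F₁] L₁, ∃ τ₂ : L₂ ≃ₐ[F₂] L₂, ∀ x, τ₂ (e' x) = e' (τ₁ x)) :
    ∃ e₀ : F₁ ≃+* F₂, ∀ a : F₁, e' (algebraMap F₁ L₁ a) = algebraMap F₂ L₂ (e₀ a) := by
  -- `e'(F₁) ⊆ F₂`: `e' a` is fixed by `Gal(L₂/F₂)`
  have hfwd : ∀ a : F₁, ∃ b : F₂, e' (algebraMap F₁ L₁ a) = algebraMap F₂ L₂ b := fun a => by
    have hfix : ∀ τ₂ : L₂ ≃ₐ[F₂] L₂, τ₂ (e' (algebraMap F₁ L₁ a)) = e' (algebraMap F₁ L₁ a) := fun τ₂ => by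
      obtain ⟨τ₁, hτ⟩ := h₁₂ τ₂
      rw [hτ, AlgEquiv.commutes]
    obtain ⟨b, hb⟩ := (IsGalois.mem_range_algebraMap_iff_fixed (F := F₂) (e' (algebraMap F₁ L₁ a))).mpr hfix
    exact ⟨b, hb.symm⟩
  -- `e'⁻¹(F₂) ⊆ F₁`
  have hbwd : ∀ b : F₂, ∃ a : F₁, e'.symm (algebraMap F₂ L₂ b) = algebraMap F₁ L₁ a := fun b => by
    have hfix : ∀ τ₁ : L₁ ≃ₐ[F₁] L₁, τ₁ (e'.symm (algebraMap F₂ L₂ b)) = e'.symm (algebraMap F₂ L₂ b) := by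
      intro τ₁
      obtain ⟨τ₂, hτ⟩ := h₂₁ τ₁
      apply e'.injective
      rw [← hτ, RingEquiv.apply_symm_apply, AlgEquiv.commutes]
    obtain ⟨a, ha⟩ := (IsGalois.mem_range_algebraMap_iff_fixed (F := F₁) (e'.symm (algebraMap F₂ L₂ b))).mpr hfix
    exact ⟨a, ha.symm⟩
  obtain ⟨φ, hφ⟩ := exists_ringHom_of_range ((e' : L₁ →+* L₂).comp (algebraMap F₁ L₁)) hfwd
  have hsurj : Function.Surjective φ := fun b => by
    obtain ⟨a, ha⟩ := hbwd b
    refine ⟨a, (algebraMap F₂ L₂).injective ?_⟩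
    rw [← hφ, RingHom.comp_apply, RingHom.coe_coe, ← ha, RingEquiv.apply_symm_apply]
  refine ⟨RingEquiv.ofBijective φ ⟨φ.injective, hsurj⟩, fun a => ?_⟩
  rw [RingEquiv.ofBijective_apply, ← hφ]
  rfl

end FieldTheory

/-! ### The clause at the data, faithful archimedean action -/

section Arith

variable {F₁ : Type} [Field F₁] [NumberField F₁] {K₁ : Type} [Field K₁] [Algebra F₁ K₁] [IsGalois F₁ K₁]
variable {F₂ : Type} [Field F₂] [NumberField F₂] {K₂ : Type} [Field K₂] [Algebra F₂ K₂] [IsGalois F₂ K₂]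

/-- An `F`-algebra endomorphism of a finite extension is an automorphism; as an element of `Gal(L/ℚ)`.
[cite: MochizukiFrdI2008, Thm. 6.4 (iv) p.115] -/
theorem exists_algEquiv_rat_eq {F L : Type} [Field F] [Field L] [NumberField L] [Algebra F L] [FiniteDimensional F L]
    (f : L →ₐ[F] L) : ∃ σ : L ≃ₐ[ℚ] L, ∀ x, σ x = f x := by
  let σ := AlgEquiv.ofBijective f (Algebra.IsAlgebraic.algHom_bijective f)
  refine ⟨AlgEquiv.ofRingEquiv (f := σ.toRingEquiv) fun q => ?_, fun x => rfl⟩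
  change f (algebraMap ℚ L q) = algebraMap ℚ L q
  exact (f : L →+* L).map_rat_algebraMap q

/-- **[FrdI] Thm. 6.4 (iv), the compatibility clause AT THE CONSTRUCTIONS, faithful case**: for an equivalence
`Ψ : C_{K₁/F₁} ⥲ C_{K₂/F₂}` of arithmetic Frobenioids with Cor. 4.11 (iv) datum `(Ψ^Base, Ψ^Φ, η)` and `X = Spec L₁`
with `L₁` Galois over `ℚ` whose Galois group acts FAITHFULLY on the infinite places (i.e. `L₁` totally real or
non-CM), `L₂ := (Ψ^Base X).L` is isomorphic to `L₁` compatibly with an isomorphism `F₁ ≅ F₂` — for ARBITRARY `F₁`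
(no Galois / solitary / degree hypothesis). [cite: MochizukiFrdI2008, Thm. 6.4 (iv) p.115] -/
theorem Thm64iv_arith_compat_of_faithful (Ψ : arithFrobenioid F₁ K₁ ≌ arithFrobenioid F₂ K₂)
    {ΨBase : FinSubextCat F₁ K₁ ⥤ FinSubextCat F₂ K₂} [ΨBase.IsEquivalence]
    (E : PreFrobenioidData.DivisorMonoidIsoOverBase (arithFrobenioidOps F₁ K₁) (arithFrobenioidOps F₂ K₂) ΨBase)
    (η : Ψ.functor ⋙ (arithFrobenioidOps F₂ K₂).base ≅ (arithFrobenioidOps F₁ K₁).base ⋙ ΨBase)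
    (hdiv : ∀ ⦃A B : arithFrobenioid F₁ K₁⦄ (φ : A ⟶ B),
      (arithFrobenioidOps F₂ K₂).div (Ψ.functor.map φ) =
        (arithFrobenioidOps F₂ K₂).pull (η.hom.app A)
          (E.iso ((arithFrobenioidOps F₁ K₁).base.obj A) ((arithFrobenioidOps F₁ K₁).div φ)))
    (X : FinSubextCat F₁ K₁) (hX : IsGalois ℚ X.L)
    (hfaith : ∀ g : X.L ≃ₐ[ℚ] X.L, (∀ v : InfinitePlace X.L, g • v = v) → g = 1) :
    ∃ (e : X.L ≃+* (ΨBase.obj X).L) (e₀ : F₁ ≃+* F₂),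
      ∀ a : F₁, e (algebraMap F₁ X.L a) = algebraMap F₂ (ΨBase.obj X).L (e₀ a) := by
  classical
  haveI := hX
  -- the field isomorphism `e₁ : L₁ ≅ L₂` (abc-iut-L1-d7) and the Galois structures
  obtain ⟨e₁⟩ := Thm64iv_arith_fieldIso Ψ E η hdiv X hX
  haveI : IsScalarTower ℚ F₁ X.L :=
    IsScalarTower.of_algebraMap_eq fun q => ((algebraMap F₁ X.L).map_rat_algebraMap q).symm
  haveI : IsScalarTower ℚ F₂ (ΨBase.obj X).L :=
    IsScalarTower.of_algebraMap_eq fun q => ((algebraMap F₂ (ΨBase.obj X).L).map_rat_algebraMap q).symm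
  let e₁ℚ : X.L ≃ₐ[ℚ] (ΨBase.obj X).L :=
    AlgEquiv.ofRingEquiv (f := e₁) fun q => (e₁ : X.L →+* (ΨBase.obj X).L).map_rat_algebraMap q
  haveI : IsGalois ℚ (ΨBase.obj X).L := IsGalois.of_algEquiv e₁ℚ
  haveI : IsGalois F₁ X.L := IsGalois.tower_top_of_isGalois ℚ F₁ X.L
  haveI : IsGalois F₂ (ΨBase.obj X).L := IsGalois.tower_top_of_isGalois ℚ F₂ (ΨBase.obj X).L
  -- the archimedean transport is `s • ·`
  obtain ⟨πi, s, hequiv, hs⟩ := arith_archTransport_galois Ψ E η hdiv X hX e₁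
  -- the conjugation `α h := e₁⁻¹ ∘ Ψ^Base(h) ∘ e₁` equals `s σ_h s⁻¹` for every `h ∈ Aut(X)`
  have key : ∀ (h : X ⟶ X) (x : X.L),
      e₁.symm ((ΨBase.map h).toAlgHom (e₁ x)) = s (h.toAlgHom (s.symm x)) := by
    intro h
    obtain ⟨σ, hσ⟩ := exists_algEquiv_rat_eq (F := F₁) h.toAlgHom
    obtain ⟨σ', hσ'⟩ := exists_algEquiv_rat_eq (F := F₂) (ΨBase.map h).toAlgHom
    -- `α := e₁⁻¹ σ' e₁` as an element of `Gal(L₁/ℚ)`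
    let αr : X.L ≃+* X.L := e₁.trans (σ'.toRingEquiv.trans e₁.symm)
    let α : X.L ≃ₐ[ℚ] X.L := AlgEquiv.ofRingEquiv (f := αr) fun q => (αr : X.L →+* X.L).map_rat_algebraMap q
    have hα : ∀ x, α x = e₁.symm (σ' (e₁ x)) := fun x => rfl
    -- equivariance of `π_∞` in terms of `σ`, `α`: `s σ⁻¹ • v = α⁻¹ s • v`
    have hact : ∀ v : InfinitePlace X.L, (s * σ⁻¹) • v = (α⁻¹ * s) • v := by
      intro v
      have h1 := hequiv h v
      have h2 := hs (v.comap (h.toAlgHom : X.L →+* X.L))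
      rw [h1, ← InfinitePlace.comap_comp] at h2
      -- `Ψ^Base(h) ∘ e₁ = e₁ ∘ α`
      have hcomp : (((ΨBase.map h).toAlgHom : (ΨBase.obj X).L →+* (ΨBase.obj X).L).comp
          (e₁ : X.L →+* (ΨBase.obj X).L)) = (e₁ : X.L →+* (ΨBase.obj X).L).comp (α : X.L →+* X.L) := by
        refine RingHom.ext fun x => ?_
        simp only [RingHom.coe_comp, RingHom.coe_coe, Function.comp_apply, hα, RingEquiv.apply_symm_apply]
        exact (hσ' (e₁ x)).symm
      rw [hcomp, InfinitePlace.comap_comp, hs v] at h2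
      -- `h2 : (s • v).comap α = s • v.comap σ_h`
      have hvσ : v.comap (h.toAlgHom : X.L →+* X.L) = σ⁻¹ • v := by
        rw [smul_eq_comap, AlgEquiv.aut_inv, AlgEquiv.symm_symm]
        congr 1
        exact RingHom.ext fun x => (hσ x).symm
      have hαv : (s • v).comap (α : X.L →+* X.L) = α⁻¹ • (s • v) := by
        rw [smul_eq_comap (α⁻¹), AlgEquiv.aut_inv, AlgEquiv.symm_symm]
      rw [hvσ, hαv, ← mul_smul, ← mul_smul] at h2
      exact h2.symm
    have hone : (α⁻¹ * s)⁻¹ * (s * σ⁻¹) = 1 := hfaith _ fun v => by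
      rw [mul_smul, hact v, inv_smul_smul]
    have hαeq : α = s * σ * s⁻¹ := by
      rw [mul_inv_rev, inv_inv] at hone
      -- `hone : s⁻¹ * α * (s * σ⁻¹) = 1`
      calc α = s * (s⁻¹ * α * (s * σ⁻¹)) * (σ * s⁻¹) := by group
        _ = s * 1 * (σ * s⁻¹) := by rw [hone]
        _ = s * σ * s⁻¹ := by group
    intro x
    have := congrArg (fun β : X.L ≃ₐ[ℚ] X.L => β x) hαeq
    simp only [AlgEquiv.mul_apply] at this
    rw [hα, hσ'] at this
    rw [this, hσ, AlgEquiv.aut_inv]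
  -- `e := e₁ ∘ s` intertwines both Galois groups
  let e : X.L ≃+* (ΨBase.obj X).L := s.toRingEquiv.trans e₁
  have he : ∀ x, e x = e₁ (s x) := fun x => rfl
  refine ⟨e, ?_⟩
  refine exists_baseRingEquiv_of_conj e (fun τ₂ => ?_) (fun τ₁ => ?_)
  · -- `τ₂ = Ψ^Base(h)` for `h := Ψ^Base⁻¹ ⟨τ₂⟩`
    let h : X ⟶ X := ΨBase.preimage (FinSubextCat.Hom.mk τ₂.toAlgHom : ΨBase.obj X ⟶ ΨBase.obj X)
    have hh : (ΨBase.map h).toAlgHom = τ₂.toAlgHom := by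
      rw [ΨBase.map_preimage]
    refine ⟨AlgEquiv.ofBijective h.toAlgHom (Algebra.IsAlgebraic.algHom_bijective _), fun x => ?_⟩
    rw [he, he, AlgEquiv.ofBijective_apply]
    have := key h (s x)
    rw [hh, AlgEquiv.symm_apply_apply] at this
    change τ₂ (e₁ (s x)) = _
    rw [← e₁.apply_symm_apply (τ₂ (e₁ (s x)))]
    congr 1
  · let h : X ⟶ X := FinSubextCat.Hom.mk τ₁.toAlgHom
    obtain ⟨τ₂, hτ₂⟩ := exists_algEquiv_rat_eq (F := F₂) (ΨBase.map h).toAlgHom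
    refine ⟨AlgEquiv.ofRingEquiv (f := τ₂.toRingEquiv) fun b => ?_, fun x => ?_⟩
    · change τ₂ (algebraMap F₂ _ b) = _
      rw [hτ₂, AlgHom.commutes]
    · change τ₂ (e x) = _
      rw [he, he, hτ₂]
      have := key h (s x)
      rw [AlgEquiv.symm_apply_apply] at this
      rw [← e₁.apply_symm_apply ((ΨBase.map h).toAlgHom (e₁ (s x))), this]
      rfl

end Arith

end Literature.AlgebraicGeometry.Frobenioids

end
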